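import Summits.BirchSwinnertonDyer.Rank1Residual.Partition.MainConjecturesIrreducibleBDP
import Literature.NumberTheory.EllipticCurves.BurungaleCastellaSkinner2025.BDPMainConjectureRationalAtTrivialCharacter
import HarnessLib

/-!
# The (IMC≥∘BDP)ᵍ link at a good ordinary `p > 3` with `E[p]` IRREDUCIBLE — surjective OR NOT —
# FROM PUBLISHED FACTS: Burungale–Castella–Skinner 2025 Thm. 1.2.4 (a) + Prop. 4.2.2 ∘ CGLS 2022
# Thm. 5.1.3 (`thm124a_prop422_thm513_generator_constantCoeff`) + Jetchev–Skinner–Wan 2017 Thm. 3.3.1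
# (cell `bsd-print-x9`, prover seat p4, Heegner road; the (irr) twin of
# `Partition/MainConjecturesIrreducibleBDP.lean` §1–§4, which needs (sur))

HONEST FRAMING (cell `run/shared/lean/pub/bsd-print-x9/`, D-0131 print tier): THEOREMS ONLY (no
definition, no named fact, no `sorry`); every published theorem enters as one of the tree's named
Literature facts BY NAME; nothing about any particular curve is asserted; no label changes. The
named fact consumed here, `BurungaleCastellaSkinner2025.thm124a_prop422_thm513_generator_constantCoeff`
(p533331), is the COMPOSITE of three printed statements assembled by a two-line `μ`-comparison (flag
`BCS25-124a+422-mu-composite` offered in its docstring; inherited `BCS25-IMC-equiv@BSTW`): it says that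
at the data of BCS Thm. 1.2.4 with (irr_ℚ) and (irr_K), a generator `𝓕` of `ch_Λ(X_Gr(E/K_∞⁻))`
satisfies `𝓕(0) = u · p^k · c_E⁻² (1 − a_p p⁻¹ + p⁻¹)² log_{ω_E}(P_K)²` with `u ∈ ℤ_p^×`, `k : ℕ` — a
ONE-SIDED statement (`L_p^BDP ∣ 𝓕` read at `𝟙`), which is exactly the direction STEP L of the
rank-one `p`-part consumes.

## What this file proves (every line the (irr) twin of a theorem of `MainConjecturesIrreducibleBDP.lean`)

* §1 `X11b.imcLowerWaldspurgerOnTreeGoodAt_of_thm124a` — the cell's ONE-SIDED link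
  `IMCLowerWaldspurgerOnTreeGoodAt p κ v̄ γ ι P` (CGLS letter: module strict at `v̄`, log along `ι ↦ v`)
  from the fact at every datum with a Manin-unit parametrisation (`p ∤ c_E`), GIVEN one generator of
  `ch_Λ(X_Gr)` with non-zero constant term.
* §2 `X11b.imcLowerWaldspurgerOnTreeGoodAt_of_thm124a_of_thm331` — that generator supplied by
  Jetchev–Skinner–Wan 2017 Thm. 3.3.1 at THE embedding `embAt v̄` (hypothesis (irr_K), NOT (sur); no
  anomaly restriction).
* §3 `X11b.imcLowerWaldspurgerOnTreeGoodAt_inducedPlace_of_thm124a_of_thm331` — the SAME link in the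
  JSW/Castella letter `IMCLowerWaldspurgerOnTreeGoodAt p κ (inducedPlace ι) γ ι P` for EVERY embedding
  `ι : K ↪ ℚ_p`, through the σ-bridge of the sibling (`exists_involutive_comp_eq`,
  `padicLogOrd_comp_eq_of_rank_one`: the two log valuations agree in rank one).
* §4 `X11b.imcLowerWaldspurgerOnTreeGoodAt_inducedPlace_of_heegner_of_thm124a_of_thm331` — at a
  classical Heegner datum with `P_K` non-torsion (rank one and finite `Ш` over `K` by Kolyvagin):
  EXACTLY the `hLA` binder of `X9.bsdp_rankOne_of_thm331_of_x9IntegralMainConjecture`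
  (`Theorems/PrintX9HeegnerRankOne.lean`'s companion) and of the covered rows' class theorems, now
  DISCHARGED at every pair with `E[p]` irreducible — in particular on class X9 (irreducible
  NON-surjective image), where the (sur)-sibling is void.

References: [BurungaleCastellaSkinner2025] Thm. 1.2.4 (a), Prop. 4.2.2, proof of Cor. 1.3.1 (p. 4);
[CastellaGrossiLeeSkinner2022] Thm. 5.1.3; [Hsieh2014] Thm. B (source of Prop. 4.2.2);
[JetchevSkinnerWan2017] Thm. 3.3.1, §7.4.1; [Castella2018] Thm. 2.3, §5; [Kolyvagin1990] Thm. A; the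
sibling `Partition/MainConjecturesIrreducibleBDP.lean` (GLUE seat gen 6, the (sur) case).
-/

set_option autoImplicit false

noncomputable section

open scoped Classical

open WeierstrassCurve NumberField IsDedekindDomain Literature.NumberTheory.EllipticCurves
  Literature.NumberTheory.EllipticCurves.ModularForms Literature.NumberTheory.Automorphic
  Literature.NumberTheory.EllipticCurves.Rank1Residual
  Literature.NumberTheory.EllipticCurves.BurungaleCastellaSkinner2025
  Literature.NumberTheory.EllipticCurves.CastellaGrossiLeeSkinner2022
  Literature.NumberTheory.EllipticCurves.JetchevSkinnerWan2017
  Summit.BirchSwinnertonDyer.BirchSwinnertonDyer.Theorems.Rank1ResidualX1Defs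

namespace Summit.BirchSwinnertonDyer.Rank1Residual

namespace X11b

/-! ### §1 `IMCLowerWaldspurgerOnTreeGoodAt` (CGLS letter) from the (irr) fact, given a generator -/

section IMC

variable {W : WeierstrassCurve ℚ} [W.IsElliptic] [W.IsGloballyMinimal] {p : ℕ} [Fact p.Prime]
  {K : Type} [Field K] [NumberField K]

/-- **`X11b.IMCLowerWaldspurgerOnTreeGoodAt p κ v̄ γ ι P` FROM Burungale–Castella–Skinner 2025 Thm.
1.2.4 (a) + Prop. 4.2.2 ∘ CGLS 2022 Thm. 5.1.3**, at every datum of the fact — `p > 3` good ordinary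
with (irr_ℚ) (surjective OR NOT), `K` imaginary quadratic with (Heeg) for `N = N_E`, (spl), (disc)
`D_K` odd `≠ −3`, (irr_K), `ι : K ↪ ℚ_p` inducing `v`, `v̄ ∋ p` the other (STRICT) prime, `κ`
anticyclotomic with generator `γ`, `P = P_K` the Heegner point of `(Dt, H, ιC)` — for a
parametrisation with `p ∤ c_E` (then the Manin term of the fact vanishes), GIVEN one generator `G`
of `ch_Λ(X_Gr)` with `G(0) ≠ 0` (supplied by a control theorem, §2): the ONE-SIDED inequality
`2·(ord_p log_ω P + ord_p(1 − a_p + p) − 1) ≤ ord_p G(0)` (the defect being the exponent `k = μ(G) ≥ 0`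
of the fact). Through the defeq bridge (`AcSelmer.hasCharValuationAt_iff_literature`,
`padicLogOrd_eq_literature`). The (irr) twin of `imcWaldspurgerOnTreeGoodAt_of_thm124b`.
[cite: BurungaleCastellaSkinner2025, Thm. 1.2.4 (a) (p. 3), Prop. 4.2.2 (pp. 8–9) and proof of Cor. 1.3.1 (p. 4)]
[cite: CastellaGrossiLeeSkinner2022, Thm. 5.1.3] [cite: Castella2018, §5 (eq:IMC+BDP) (arXiv:1704.06608 p. 12)] -/
theorem imcLowerWaldspurgerOnTreeGoodAt_of_thm124a
    (h124 : thm124a_prop422_thm513_generator_constantCoeff)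
    (hp : 3 < p) (hord : GoodOrd W p) (hirr : Irr W p) (hK : IsImaginaryQuadratic K)
    (hodd : Odd (NumberField.discr K)) (h3 : NumberField.discr K ≠ -3)
    {N : ℕ} [NeZero N] (hN : W.conductorNorm ℤ = N) (hHN : SatisfiesHeegnerHypothesis N K)
    (hHp : SatisfiesHeegnerHypothesis p K) (hirrK : (W.baseChange K).HasIrreducibleModPGaloisRep p)
    (ι : K →+* ℚ_[p]) (v vbar : HeightOneSpectrum (𝓞 K))
    (hv : ∀ x : 𝓞 K, x ∈ v.asIdeal ↔ ‖ι (x : K)‖ < 1)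
    (hvbar : ((p : ℕ) : 𝓞 K) ∈ vbar.asIdeal) (hne : vbar ≠ v)
    (κ : ZpExtension K p) (hκ : κ.IsAnticyclotomic)
    (γ : Field.absoluteGaloisGroup K) [Fact (κ.IsTopGenerator γ)]
    (Dt : ModularParametrizationData W N) (hc : ¬ (p : ℤ) ∣ Dt.c)
    (H : HeegnerDatum N (NumberField.discr K)) (ιC : K →+* ℂ) (P : (W.baseChange K).toAffine.Point)
    (hP : WeierstrassCurve.Affine.Point.map ιC.toRatAlgHom P = heegnerPointComplex Dt H)
    (G : IwasawaAlgebra p)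
    (hG : Literature.NumberTheory.EllipticCurves.Castella2018.AcSelmer.XAc.charIdeal (W.baseChange K) p
      κ vbar ∅ γ = Ideal.span {G})
    (hG0 : PowerSeries.constantCoeff G ≠ 0) :
    IMCLowerWaldspurgerOnTreeGoodAt p κ vbar γ ι P := by
  have hHN' : SatisfiesHeegnerHypothesis (W.conductorNorm ℤ) K := by rw [hN]; exact hHN
  obtain ⟨n, hn, hval⟩ := hasCharValuationAt_ge_of_thm124a h124 hp hord hirr K hK hHN' hHp hodd h3
    hirrK ι v vbar hv hvbar hne κ hκ γ Dt H ιC P hP G hG hG0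
  have hc0 : padicValInt p Dt.c = 0 := padicValInt.eq_zero_of_not_dvd hc
  refine ⟨n, (AcSelmer.hasCharValuationAt_iff_literature _ p κ vbar ∅ γ n).mpr hn, ?_⟩
  rw [padicLogOrd_eq_literature]
  omega

/-! ### §2 The generator from the published control theorem (JSW 3.3.1: (irr_K), NOT (sur)) -/

/-- **(IMC≥∘BDP)ᵍ, CGLS letter, from BCS 1.2.4 (a) + 4.2.2 ∘ CGLS 5.1.3 + JSW 3.3.1** — NO anomaly
restriction, NO surjectivity: the generator with `𝓕(0) ≠ 0` of `ch_Λ(X_ac)` for the module STRICT AT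
`v̄` comes from Jetchev–Skinner–Wan 2017 Thm. 3.3.1 applied at THE embedding `embAt v̄ : K ↪ K_v̄ = ℚ_p`
(`mem_asIdeal_iff_norm_embAt_lt_one`; `v̄` has degree one as `p` splits); its hypothesis (irr_K) is
carried (`hirrK`) — the SAME binder the fact needs for Prop. 4.2.2. The (irr) twin of
`imcWaldspurgerOnTreeGoodAt_of_thm124b_of_thm331`. [cite: BurungaleCastellaSkinner2025, Thm. 1.2.4 (a), Prop. 4.2.2]
[cite: CastellaGrossiLeeSkinner2022, Thm. 5.1.3] [cite: JetchevSkinnerWan2017, Thm. 3.3.1] -/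
theorem imcLowerWaldspurgerOnTreeGoodAt_of_thm124a_of_thm331
    (h124 : thm124a_prop422_thm513_generator_constantCoeff) (h331 : thm331_anticyclotomicControl)
    (hp : 3 < p) (hord : GoodOrd W p) (hirr : Irr W p)
    (hK : IsImaginaryQuadratic K) (hodd : Odd (NumberField.discr K)) (h3 : NumberField.discr K ≠ -3)
    {N : ℕ} [NeZero N] (hN : W.conductorNorm ℤ = N) (hHN : SatisfiesHeegnerHypothesis N K)
    (hHp : SatisfiesHeegnerHypothesis p K) (hirrK : (W.baseChange K).HasIrreducibleModPGaloisRep p)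
    (ι : K →+* ℚ_[p]) (v vbar : HeightOneSpectrum (𝓞 K))
    (hv : ∀ x : 𝓞 K, x ∈ v.asIdeal ↔ ‖ι (x : K)‖ < 1)
    (hvbar : ((p : ℕ) : 𝓞 K) ∈ vbar.asIdeal) (hne : vbar ≠ v)
    (κ : ZpExtension K p) (hκ : κ.IsAnticyclotomic)
    (γ : Field.absoluteGaloisGroup K) [Fact (κ.IsTopGenerator γ)]
    (Dt : ModularParametrizationData W N) (hc : ¬ (p : ℤ) ∣ Dt.c)
    (H : HeegnerDatum N (NumberField.discr K)) (ιC : K →+* ℂ) (P : (W.baseChange K).toAffine.Point)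
    (hP : WeierstrassCurve.Affine.Point.map ιC.toRatAlgHom P = heegnerPointComplex Dt H)
    (hrk : (W.baseChange K).mordellWeilRank = 1)
    (hfinp : Finite (AddCommGroup.primaryComponent (W.baseChange K).sha p))
    (hPinf : ¬ IsOfFinAddOrder P) :
    IMCLowerWaldspurgerOnTreeGoodAt p κ vbar γ ι P := by
  have hHN' : SatisfiesHeegnerHypothesis (W.conductorNorm ℤ) K := by rw [hN]; exact hHN
  -- `v̄` has degree one (`p` splits in the quadratic `K`), so `embAt v̄ : K ↪ ℚ_p` induces `v̄`
  have hsplit : SplitsIn K p := hHp p Fact.out (dvd_refl p)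
  obtain ⟨he, hf⟩ := degreeOne_of_splitsIn hK.1 hsplit hvbar
  obtain ⟨-, F, hF, hF0, -⟩ := h331 W p (by omega) hord.1 K hK hHp hHN' hirrK
    (embAt K p vbar hvbar he hf) vbar (mem_asIdeal_iff_norm_embAt_lt_one vbar hvbar he hf) κ hκ γ hrk
    hfinp P hPinf
  exact imcLowerWaldspurgerOnTreeGoodAt_of_thm124a h124 hp hord hirr hK hodd h3 hN hHN hHp hirrK ι v
    vbar hv hvbar hne κ hκ γ Dt hc H ιC P hP F hF hF0

/-! ### §3 The JSW letter: module strict at the induced prime, log along the same embedding -/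

/-- **(IMC≥∘BDP)ᵍ in the JSW / Castella letter `IMCLowerWaldspurgerOnTreeGoodAt p κ (inducedPlace ι) γ ι
P` from BCS 1.2.4 (a) + 4.2.2 ∘ CGLS 5.1.3 + JSW 3.3.1**, for EVERY embedding `ι : K ↪ ℚ_p`, in rank
one, with `E[p]` irreducible (surjective or not). Let `v = inducedPlace ι` and `w ≠ v` the other prime
above `p` (`exists_other_prime`); the fact at the embedding `embAt w` (inducing `w`), strict prime `v`,
gives `2·(ord_p(1 − a_p + p) − 1 + ord_p log_{embAt w} P) ≤ ord_p 𝓖(0)` for every generator `𝓖` of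
`ch_Λ(X_ac(κ, v))` with `𝓖(0) ≠ 0` — one exists by JSW 3.3.1 at `(ι, v)` —, and `embAt w = ι ∘ σ` for
an involution `σ` of `K` (`exists_involutive_comp_eq`), so `ord_p log_{embAt w} P = ord_p log_ι P`
(`padicLogOrd_comp_eq_of_rank_one`: `σ_* P = ±P +` torsion in rank one, `p ≠ 2`). The (irr) twin of
`imcWaldspurgerOnTreeGoodAt_inducedPlace_of_thm124b_of_thm331`.
[cite: BurungaleCastellaSkinner2025, Thm. 1.2.4 (a) (p. 3), Prop. 4.2.2] [cite: CastellaGrossiLeeSkinner2022, Thm. 5.1.3]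
[cite: JetchevSkinnerWan2017, Thm. 3.3.1, §2.3.2 (p. 7)] [cite: Castella2018, Thm. 2.3, §5 (eq:IMC+BDP)] -/
theorem imcLowerWaldspurgerOnTreeGoodAt_inducedPlace_of_thm124a_of_thm331
    (h124 : thm124a_prop422_thm513_generator_constantCoeff) (h331 : thm331_anticyclotomicControl)
    (hp : 3 < p) (hord : GoodOrd W p) (hirr : Irr W p)
    (hK : IsImaginaryQuadratic K) (hodd : Odd (NumberField.discr K)) (h3 : NumberField.discr K ≠ -3)
    {N : ℕ} [NeZero N] (hN : W.conductorNorm ℤ = N) (hHN : SatisfiesHeegnerHypothesis N K)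
    (hHp : SatisfiesHeegnerHypothesis p K) (hirrK : (W.baseChange K).HasIrreducibleModPGaloisRep p)
    (ι : K →+* ℚ_[p]) (κ : ZpExtension K p) (hκ : κ.IsAnticyclotomic)
    (γ : Field.absoluteGaloisGroup K) [Fact (κ.IsTopGenerator γ)]
    (Dt : ModularParametrizationData W N) (hc : ¬ (p : ℤ) ∣ Dt.c)
    (H : HeegnerDatum N (NumberField.discr K)) (ιC : K →+* ℂ) (P : (W.baseChange K).toAffine.Point)
    (hP : WeierstrassCurve.Affine.Point.map ιC.toRatAlgHom P = heegnerPointComplex Dt H)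
    (hrk : (W.baseChange K).mordellWeilRank = 1)
    (hfinp : Finite (AddCommGroup.primaryComponent (W.baseChange K).sha p))
    (hPinf : ¬ IsOfFinAddOrder P) :
    IMCLowerWaldspurgerOnTreeGoodAt p κ (inducedPlace ι) γ ι P := by
  have hHN' : SatisfiesHeegnerHypothesis (W.conductorNorm ℤ) K := by rw [hN]; exact hHN
  -- the other prime `w` above `p`, of degree one, and THE embedding at it
  obtain ⟨w, hw, hwne⟩ := exists_other_prime hHp (inducedPlace ι) (natCast_mem_inducedPlace ι)
  have hsplit : SplitsIn K p := hHp p Fact.out (dvd_refl p)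
  obtain ⟨he, hf⟩ := degreeOne_of_splitsIn hK.1 hsplit hw
  set ιw : K →+* ℚ_[p] := embAt K p w hw he hf with hιw
  -- a generator with non-zero constant term of the module strict at `v = inducedPlace ι`, from JSW
  obtain ⟨-, F, hF, hF0, -⟩ := h331 W p (by omega) hord.1 K hK hHp hHN' hirrK ι (inducedPlace ι)
    (mem_inducedPlace_iff ι) κ hκ γ hrk hfinp P hPinf
  -- BCS (a) + 4.2.2 ∘ BDP at the embedding `ιw` (inducing `w`), strict prime `inducedPlace ι`
  obtain ⟨n, hn, hval⟩ := hasCharValuationAt_ge_of_thm124a h124 hp hord hirr K hK hHN' hHp hodd h3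
    hirrK ιw w (inducedPlace ι) (mem_asIdeal_iff_norm_embAt_lt_one w hw he hf)
    (natCast_mem_inducedPlace ι) (fun h ↦ hwne h.symm) κ hκ γ Dt H ιC P hP F hF hF0
  -- `ιw = ι ∘ σ` for an involution `σ`; the log valuations agree in rank one
  obtain ⟨σ, hσ, hισ⟩ := exists_involutive_comp_eq hK.1 ι ιw
  have hlog : Literature.NumberTheory.EllipticCurves.padicLogOrd W p ιw P = padicLogOrd W p ι P := by
    rw [← hισ, ← padicLogOrd_eq_literature]
    exact padicLogOrd_comp_eq_of_rank_one W p (by omega) σ hσ ι hrk P hPinf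
  have hc0 : padicValInt p Dt.c = 0 := padicValInt.eq_zero_of_not_dvd hc
  refine ⟨n, (AcSelmer.hasCharValuationAt_iff_literature _ p κ (inducedPlace ι) ∅ γ n).mpr hn, ?_⟩
  rw [hlog] at hval
  omega

end IMC

/-! ### §4 The `hLA` binder of the rank-one theorems at a classical Heegner datum, DISCHARGED under (irr) -/

section Datum

variable (W : WeierstrassCurve ℚ) [W.IsElliptic] [W.IsGloballyMinimal] (p : ℕ) [Fact p.Prime]
  (N : ℕ) [NeZero N] (K : Type) [Field K] [NumberField K]
  (Dt : ModularParametrizationData W N) (H : HeegnerDatum N (NumberField.discr K)) (ιC : K →+* ℂ)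
  (P : (W.baseChange K).toAffine.Point)

/-- **The `hLA` binder (JSW letter) at a classical Heegner datum with `P_K` non-torsion, from BCS
1.2.4 (a) + 4.2.2 ∘ CGLS 5.1.3 + JSW 3.3.1 + the σ-bridge** — every pair `p > 3` good ordinary with
`E[p]` IRREDUCIBLE (surjective or not), anomalous or not; (irr_K) carried; rank one and finite `Ш` over
`K` by Kolyvagin (`hKo`); `d_K < −4` gives `d_K ≠ −3`. The (irr) twin of
`imcLowerWaldspurgerOnTreeGoodAt_inducedPlace_of_heegner_of_thm124b_of_thm331`; on class X9 it is the
only one that applies. [cite: BurungaleCastellaSkinner2025, Thm. 1.2.4 (a), Prop. 4.2.2, proof of Cor. 1.3.1 (p. 4)]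
[cite: JetchevSkinnerWan2017, Thm. 3.3.1, §7.4.1] [cite: Kolyvagin1990, Thm. A] -/
theorem imcLowerWaldspurgerOnTreeGoodAt_inducedPlace_of_heegner_of_thm124a_of_thm331
    (h124 : thm124a_prop422_thm513_generator_constantCoeff) (h331 : thm331_anticyclotomicControl)
    (hKo : kolyvagin N W K)
    (hp : 3 < p) (hord : GoodOrd W p) (hirr : Irr W p)
    (hirrK : (W.baseChange K).HasIrreducibleModPGaloisRep p)
    (hN : W.conductorNorm ℤ = N) (hK : IsImaginaryQuadratic K)
    (hodd : Odd (NumberField.discr K)) (hlt : NumberField.discr K < -4)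
    (hHN : SatisfiesHeegnerHypothesis N K) (hHp : SatisfiesHeegnerHypothesis p K)
    (hP : WeierstrassCurve.Affine.Point.map ιC.toRatAlgHom P = heegnerPointComplex Dt H)
    (hc : ¬ (p : ℤ) ∣ Dt.c) (hPinf : ¬ IsOfFinAddOrder P) {κ : ZpExtension K p} (hκ : κ.IsAnticyclotomic)
    {γ : Field.absoluteGaloisGroup K} [Fact (κ.IsTopGenerator γ)] (ι : K →+* ℚ_[p]) :
    IMCLowerWaldspurgerOnTreeGoodAt p κ (inducedPlace ι) γ ι P := by
  obtain ⟨hrk, hsha⟩ := hKo hK hHN ⟨Dt, H, ιC, hP⟩ hPinf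
  haveI : Finite (W.baseChange K).sha := hsha
  exact imcLowerWaldspurgerOnTreeGoodAt_inducedPlace_of_thm124a_of_thm331 h124 h331 hp hord hirr hK hodd
    (by omega) hN hHN hHp hirrK ι κ hκ γ Dt hc H ιC P hP hrk inferInstance hPinf

end Datum

end X11b

end Summit.BirchSwinnertonDyer.Rank1Residual

end
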